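import Literature.AlgebraicGeometry.Resolution.BenitoVillamayor2013UnitMonomial
import Literature.AlgebraicGeometry.Resolution.OrdZeroBasics
import Literature.RingTheory.MvPolynomial.IdealOfVarsBasics
import HarnessLib

/-!
# The shade of a pure-head state `x^q + y^r·G(y)` IS Benito–Villamayor's defect at the point: `shade = ord₀ G`,
# `shade = 0 ⟺ G(0) ≠ 0 ⟺` the coefficient is «unit × the exceptional monomial» (BV 2013 Def. 7.10 / Thm. 7.11 (ii))

Topic: `Literature/AlgebraicGeometry/Resolution`. A short DICTIONARY between two typed readings of the same situation (cell
res-hironaka, librarian res-D-lib-1, LIB-NOTE 2026-08-27 «C-BV-δ = shade / pᵉ»; the bed's identity I1 «Δ·q = d_res», located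
by the F11 hand on 521/521 points, is this file's `shade_eq_ordZero_of_eq_monomial_mul` read row by row):

* H. Hauser, Bull. AMS 47 (2010) §F — the state `(F, r)` of the walk of a purely inseparable hypersurface `x^q + F(y)` kept
  cleaned, exceptional divisor `y^r`, SHADE `ord₀ F − |r|` «the order of the factor `g(y)` at the point» (`PointBlowup.State.shade`,
  `Res.PointBlowupShade`);
* A. Benito, O. Villamayor, Compositio 149 (2013) §7 — the coefficient `a = a_{pᵉ}` of the pure presentation `z^{pᵉ} + a`,
  the tight/exceptional monomial `𝔪_r = ∏ x_i^{h_i}` and Def. 7.10 / Thm. 7.11 (ii) «strong monomial case at the point» =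
  «`a` is a unit times `𝔪_r`» (`BV2013.IsUnitMonomial`, `BV2013.IsStrongMonomialCoeff`, `Res.BenitoVillamayor2013UnitMonomial`).

PROVED (coefficients in a domain `K`; the local-ring statements for any LOCAL `K[y]`-algebra `S` in which the `y_i` are
non-units — e.g. `𝒪_{𝔸ⁿ,0}`, `K⟦y⟧`, the local ring of the ambient at the point):
* `PointBlowup.State.shade_eq_ordZero_of_eq_monomial_mul` — `F = c·y^r·G`, `c ≠ 0` ⟹ `shade (F, r) = ord₀ G`;
* `PointBlowup.State.shade_eq_zero_iff_of_eq_monomial_mul` — then `shade = 0 ⟺ G(0) ≠ 0`;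
  `PointBlowup.State.shade_eq_zero_iff_of_dvd` — `y^r ∣ F` ⟹ (`shade = 0 ⟺ ∃ G, F = y^r·G ∧ G(0) ≠ 0`);
* `isUnit_algebraMap_of_constantCoeff_ne_zero` — `G(0) ≠ 0` ⟹ `G` is a unit in `S`;
* `PointBlowup.State.isUnitMonomial_algebraMap_of_shade_eq_zero` — `y^r ∣ F`, `shade = 0` ⟹
  `BV2013.IsUnitMonomial (y ↦ y·1_S) F` (Thm. 7.11 (ii) shape in `S`), and
  `PointBlowup.State.isStrongMonomialCoeff_algebraMap_of_shade_eq_zero` — if moreover some `r_i` is prime to `q`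
  (the monomial is not a `q`-th power; BV's `κ = 0`), `BV2013.IsStrongMonomialCoeff q (y ↦ y·1_S) F`.

So on pure-head rows «strong monomial case at the point» (BV) = «shade 0» = Hauser's terminal monomial case, and BV's defect
`δ = H-ord − ord 𝓜_r` at the point is `shade / pᵉ`. What BV adds beyond the shade (generic points of non-closed centres,
Thm. 7.19) is NOT here. No named facts; definition-free. AI-written; AI review is weaker than expert review.

References: H. Hauser, Bull. AMS 47 (2010) §F [Hauser2010]; A. Benito, O. E. Villamayor U., Compositio Math. 149 (2013)
Def. 7.10, Thm. 7.11 (ii), §7.4 (arXiv:1004.1803v2 p. 22 L44–53, p. 23) [BenitoVillamayoru2013]; O. Zariski, P. Samuel,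
*Commutative Algebra* II Ch. VII §1 [ZariskiSamuel1960].
-/

noncomputable section

open MvPolynomial IsLocalRing

namespace Literature.AlgebraicGeometry.Resolution

open Literature.AlgebraicGeometry.Resolution.Hauser2010 Literature.RingTheory.MvPolynomial

variable {σ : Type*} {K : Type*}

/-! ## The shade of a factorised state -/

namespace PointBlowup.State

section Domain

variable [CommRing K] [NoZeroDivisors K]

/-- **`shade (c·y^r·G, r) = ord₀ G`** (`c ≠ 0`, coefficients without zero divisors): Hauser's «order of the factor `g`».
[cite: Hauser2010, §F (definition of the shade)] [cite: ZariskiSamuel1960, Vol. II Ch. VII §1 p.130 (o(fg) = o(f) + o(g) over an integral domain)] -/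
theorem shade_eq_ordZero_of_eq_monomial_mul (s : State σ K) {c : K} (hc : c ≠ 0) (G : MvPolynomial σ K)
    (hF : s.F = monomial s.r c * G) : s.shade = ordZero G := by
  unfold State.shade
  rw [hF, ordZero_mul, ordZero_monomial _ hc]
  exact (ENat.addLECancellable_of_ne_top (ENat.coe_ne_top _)).add_tsub_cancel_left

/-- **`shade (c·y^r·G, r) = 0 ⟺ G(0) ≠ 0`** — the terminal «monomial case» of the walk.
[cite: Hauser2010, §F (definition of the shade)] [cite: BenitoVillamayoru2013, Def. 7.10, arXiv v2 p.23] -/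
theorem shade_eq_zero_iff_of_eq_monomial_mul (s : State σ K) {c : K} (hc : c ≠ 0) (G : MvPolynomial σ K)
    (hF : s.F = monomial s.r c * G) : s.shade = 0 ↔ constantCoeff G ≠ 0 := by
  rw [shade_eq_ordZero_of_eq_monomial_mul s hc G hF, ordZero_eq_zero_iff]

/-- **`y^r ∣ F` ⟹ (`shade (F, r) = 0 ⟺ F = y^r·G` with `G(0) ≠ 0`)** (`0 ≠ 1` in `K`).
[cite: Hauser2010, §F (definition of the shade)] [cite: BenitoVillamayoru2013, Def. 7.10, arXiv v2 p.23] -/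
theorem shade_eq_zero_iff_of_dvd [Nontrivial K] (s : State σ K) (hdvd : monomial s.r (1 : K) ∣ s.F) :
    s.shade = 0 ↔ ∃ G : MvPolynomial σ K, s.F = monomial s.r 1 * G ∧ constantCoeff G ≠ 0 := by
  obtain ⟨G, hG⟩ := hdvd
  rw [shade_eq_zero_iff_of_eq_monomial_mul s one_ne_zero G hG]
  constructor
  · exact fun h => ⟨G, hG, h⟩
  · rintro ⟨G', hG', h'⟩
    have hne : monomial s.r (1 : K) ≠ 0 := (monomial_eq_zero).not.mpr one_ne_zero
    have hGG' : G = G' := mul_left_cancel₀ hne (hG.symm.trans hG')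
    rwa [hGG']

end Domain

end PointBlowup.State

/-! ## Reading in a local `K[y]`-algebra where the `y_i` are non-units -/

section LocalAlgebra

variable [Field K] {S : Type*} [CommRing S] [IsLocalRing S] [Algebra (MvPolynomial σ K) S]

/-- **A polynomial with non-zero constant term is a unit in every local `K[y]`-algebra `S` with `y_i ∈ 𝔪_S`**
(`G = G(0) + (G − G(0))`, the first a unit of `K`, the second in `𝔪₀ = (y) ↦ 𝔪_S`).
[cite: ZariskiSamuel1960, Vol. II Ch. VII §1 p.131 (units = series with non-zero constant term)] -/
theorem isUnit_algebraMap_of_constantCoeff_ne_zero (hX : ∀ i, algebraMap (MvPolynomial σ K) S (X i) ∈ maximalIdeal S)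
    {G : MvPolynomial σ K} (hG : constantCoeff G ≠ 0) : IsUnit (algebraMap (MvPolynomial σ K) S G) := by
  -- `𝔪₀ ↦ 𝔪_S`
  have hmap : (MvPolynomial.idealOfVars σ K).map (algebraMap (MvPolynomial σ K) S) ≤ maximalIdeal S := by
    rw [MvPolynomial.idealOfVars, Ideal.map_span, Ideal.span_le]
    rintro _ ⟨_, ⟨i, rfl⟩, rfl⟩
    exact hX i
  have hm : algebraMap (MvPolynomial σ K) S (G - C (constantCoeff G)) ∈ maximalIdeal S :=
    hmap (Ideal.mem_map_of_mem _ (sub_C_constantCoeff_mem_idealOfVars G))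
  have hu : IsUnit (algebraMap (MvPolynomial σ K) S (C (constantCoeff G))) :=
    ((isUnit_iff_ne_zero.mpr hG).map C).map _
  by_contra hnu
  have hmem : algebraMap (MvPolynomial σ K) S G ∈ maximalIdeal S := (mem_maximalIdeal _).mpr hnu
  have hC : algebraMap (MvPolynomial σ K) S (C (constantCoeff G)) ∈ maximalIdeal S := by
    have h := (maximalIdeal S).sub_mem hmem hm
    rwa [← map_sub, sub_sub_cancel] at h
  exact (mem_maximalIdeal _).mp hC hu

omit [IsLocalRing S] in
/-- `y^r ↦ ∏ (y_i·1_S)^{r_i}`: the image of the monic monomial is BV's `excMonomial` of the images of the variables.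
[cite: BenitoVillamayoru2013, §7.9, arXiv v2 p.23] -/
theorem algebraMap_monomial_one_eq_excMonomial (r : σ →₀ ℕ) :
    algebraMap (MvPolynomial σ K) S (monomial r 1) =
      BV2013.excMonomial (fun i => algebraMap (MvPolynomial σ K) S (X i)) r := by
  classical
  rw [monomial_eq, C_1, one_mul, map_finsuppProd]
  simp only [map_pow]
  rfl

namespace PointBlowup.State

/-- **Shade `0` ⟹ BV's «unit × exceptional monomial» (Thm. 7.11 (ii) shape) in every local `K[y]`-algebra `S` with
`y_i ∈ 𝔪_S`**: if `y^r ∣ F` and `shade (F, r) = 0` then `F = u · ∏ y_i^{r_i}` in `S` with `u ∈ Sˣ`.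
[cite: BenitoVillamayoru2013, Thm. 7.11 (ii), arXiv v2 p.23] [cite: Hauser2010, §F (definition of the shade)] -/
theorem isUnitMonomial_algebraMap_of_shade_eq_zero
    (hX : ∀ i, algebraMap (MvPolynomial σ K) S (X i) ∈ maximalIdeal S) (s : State σ K)
    (hdvd : monomial s.r (1 : K) ∣ s.F) (h0 : s.shade = 0) :
    BV2013.IsUnitMonomial (fun i => algebraMap (MvPolynomial σ K) S (X i)) (algebraMap (MvPolynomial σ K) S s.F) := by
  obtain ⟨G, hG, hG0⟩ := (shade_eq_zero_iff_of_dvd s hdvd).mp h0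
  obtain ⟨u, hu⟩ := isUnit_algebraMap_of_constantCoeff_ne_zero hX hG0
  refine ⟨s.r, u, ?_⟩
  rw [hG, map_mul, ← hu, algebraMap_monomial_one_eq_excMonomial, mul_comm]

/-- **… and in BV's STRONG MONOMIAL CASE (`BV2013.IsStrongMonomialCoeff q`) as soon as some `r_i` is prime to `q`**
(the exceptional monomial is not a `q`-th power — the F11 hand's `κ = 0`).
[cite: BenitoVillamayoru2013, Def. 7.10 and Thm. 7.11 (ii), arXiv v2 p.23] [cite: Hauser2010, §F (definition of the shade)] -/
theorem isStrongMonomialCoeff_algebraMap_of_shade_eq_zero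
    (hX : ∀ i, algebraMap (MvPolynomial σ K) S (X i) ∈ maximalIdeal S) (s : State σ K)
    (hdvd : monomial s.r (1 : K) ∣ s.F) (h0 : s.shade = 0) {q : ℕ} (hq : ∃ i, ¬ q ∣ s.r i) :
    BV2013.IsStrongMonomialCoeff q (fun i => algebraMap (MvPolynomial σ K) S (X i))
      (algebraMap (MvPolynomial σ K) S s.F) := by
  obtain ⟨G, hG, hG0⟩ := (shade_eq_zero_iff_of_dvd s hdvd).mp h0
  obtain ⟨u, hu⟩ := isUnit_algebraMap_of_constantCoeff_ne_zero hX hG0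
  refine ⟨s.r, u, ?_, hq⟩
  rw [hG, map_mul, ← hu, algebraMap_monomial_one_eq_excMonomial, mul_comm]

end PointBlowup.State

end LocalAlgebra

end Literature.AlgebraicGeometry.Resolution

end
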